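import Literature.NumberTheory.EllipticCurves.GreenbergVatsal2000.CharacterLambdaCertificateOneProofs
import Literature.NumberTheory.EllipticCurves.GreenbergVatsal2000.CharacterLambdaCertificateZeroProofs
import Literature.NumberTheory.EllipticCurves.GreenbergVatsal2000.CharacterLValueThreeEvalProofs
import Summits.BirchSwinnertonDyer.Rank1Residual.Additive.ChiBranchRatLowerDvdUnitRows
import HarnessLib

/-!
# X3 certificate road at `p = 3` — the per-pair DISPLAY KIT: reading `p`-adic norms of rational
# certificate values off `padicValRat`, and `κ(γ) = 4` at `p = 3`
# (cell `bsd-eis`, seat `bsd-eis-x3` gen 4; THEOREMS ONLY, nothing booked)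

HONEST FRAMING (FULL-BSD rank-`≤ 1` programme D-0033, cell `bsd-eis`, `run/shared/lean/pub/bsd-eis/README.md`
§4): plumbing shared by the generated per-pair displays `X3CertificateDisplay<label>.lean` of the x3
certificate road (template: `X3CertificateDisplay450g2.lean` = Cremona `450g3`). After
`characterLValueC/D_three_eq_ratCast` (+ `decide`) the interpolation values are casts of explicit rational
numbers `r`; the `λ`-certificates (`order_toNat_eq_zero/one_of_isCharacterLFunctionC/D`) then ask for
`‖(r : ℚ₃)‖ = 1`, `< 1` or `≥ 1`, which this file reads off `padicValRat 3 r` (decidable on literals).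
Nothing here is specific to a curve.

* `norm_ratCast_lt_one_of_padicValRat_pos`, `one_le_norm_ratCast_of_padicValRat_nonpos` (any prime `p`;
  the `= 1` reading is the tree's `Additive.norm_ratCast_padic_eq_one_of_padicValRat_eq_zero`,
  `ChiBranchRatLowerDvdUnitRows.lean`, re-exported here by import);
* `cyclotomicGenerator_three` : `κ(γ) = 1 + 3 = 4`.

References: [GreenbergVatsal2000] §3 pp. 41–42; [Greenberg2001PastPresent] §4 p. 356.
-/

set_option autoImplicit false

noncomputable section

namespace Summit.BirchSwinnertonDyer.Rank1Residual.Additive.X3CertificateDisplayKit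

open Literature.NumberTheory.EllipticCurves

variable (p : ℕ) [hp : Fact p.Prime]

/-- `1 ≤ ‖(r : ℚ_p)‖` for a nonzero rational of `p`-adic valuation `≤ 0`. [folklore] -/
theorem one_le_norm_ratCast_of_padicValRat_nonpos {r : ℚ} (hr : r ≠ 0) (hv : padicValRat p r ≤ 0) :
    1 ≤ ‖((r : ℚ) : ℚ_[p])‖ := by
  have hrQ : ((r : ℚ) : ℚ_[p]) ≠ 0 := by exact_mod_cast hr
  rw [Padic.norm_eq_zpow_neg_valuation hrQ, Padic.valuation_ratCast]
  have hp1 : (1 : ℝ) ≤ (p : ℝ) := by exact_mod_cast hp.out.one_lt.le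
  calc (1 : ℝ) = (p : ℝ) ^ (0 : ℤ) := (zpow_zero _).symm
    _ ≤ (p : ℝ) ^ (-padicValRat p r) := zpow_le_zpow_right₀ hp1 (by omega)

/-- `‖(r : ℚ_p)‖ < 1` for `r = 0` or a rational of positive `p`-adic valuation. [folklore] -/
theorem norm_ratCast_lt_one_of_padicValRat_pos {r : ℚ} (hv : r = 0 ∨ 0 < padicValRat p r) :
    ‖((r : ℚ) : ℚ_[p])‖ < 1 := by
  rcases eq_or_ne r 0 with h0 | h0
  · rw [h0, Rat.cast_zero, norm_zero]; exact one_pos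
  have hv' : 0 < padicValRat p r := hv.resolve_left h0
  have hrQ : ((r : ℚ) : ℚ_[p]) ≠ 0 := by exact_mod_cast h0
  rw [Padic.norm_eq_zpow_neg_valuation hrQ, Padic.valuation_ratCast]
  have hp1 : (1 : ℝ) < (p : ℝ) := by exact_mod_cast hp.out.one_lt
  calc (p : ℝ) ^ (-padicValRat p r) < (p : ℝ) ^ (0 : ℤ) := zpow_lt_zpow_right₀ hp1 (by omega)
    _ = 1 := zpow_zero _

/-- **`κ(γ) = 4` at `p = 3`** (`cyclotomicGenerator 3 = 1 + 3`): the interpolation nodes of the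
`λ`-certificates are `4^{±i} − 1`. [folklore] -/
theorem cyclotomicGenerator_three : cyclotomicGenerator 3 = 4 := by decide


/-- **`B₃(x) = x³ − (3/2)x² + (1/2)x`** (Mathlib's `Polynomial.bernoulli 3`; for the third interpolation
value `characterLValueC/D 3 θ Σ₀ 3` of the `λ = 2` certificates). [folklore] -/
theorem bernoulli_three_eval (x : ℚ) :
    (Polynomial.bernoulli 3).eval x = x ^ 3 - 3 / 2 * x ^ 2 + 1 / 2 * x := by
  simp_rw [Polynomial.bernoulli, Finset.sum_range_succ, Polynomial.eval_add, Polynomial.eval_monomial]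
  rw [Finset.sum_range_zero, Polynomial.eval_zero, zero_add, _root_.bernoulli_one, _root_.bernoulli_zero,
    _root_.bernoulli_two, bernoulli_eq_bernoulli'_of_ne_one (by decide : (3 : ℕ) ≠ 1), bernoulli'_three]
  norm_num [Nat.choose]
  ring


/-- **`B₅(x) = x⁵ − (5/2)x⁴ + (5/3)x³ − (1/6)x`** (Mathlib's `Polynomial.bernoulli 5`; for the fifth interpolation
value `characterLValueC/D 3 θ Σ₀ 5` of the `λ = 4` certificates). [folklore] -/
theorem bernoulli_five_eval (x : ℚ) :
    (Polynomial.bernoulli 5).eval x = x ^ 5 - 5 / 2 * x ^ 4 + 5 / 3 * x ^ 3 - 1 / 6 * x := by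
  simp_rw [Polynomial.bernoulli, Finset.sum_range_succ, Polynomial.eval_add, Polynomial.eval_monomial]
  rw [Finset.sum_range_zero, Polynomial.eval_zero, zero_add, _root_.bernoulli_one, _root_.bernoulli_zero,
    _root_.bernoulli_two, bernoulli_eq_bernoulli'_of_ne_one (by decide : (3 : ℕ) ≠ 1), bernoulli'_three,
    bernoulli_eq_bernoulli'_of_ne_one (by decide : (4 : ℕ) ≠ 1), bernoulli'_four,
    bernoulli_eq_bernoulli'_of_ne_one (by decide : (5 : ℕ) ≠ 1)]
  have h5 : bernoulli' 5 = 0 := by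
    exact bernoulli'_eq_zero_of_odd (by decide : Odd 5) (by decide : 1 < 5)
  rw [h5]
  norm_num [Nat.choose]
  ring

end Summit.BirchSwinnertonDyer.Rank1Residual.Additive.X3CertificateDisplayKit

end
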